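import Summits.QuantumFields.BalabanUV.Beta.FP.PerfectPropagatorBound

/-!
# `BalabanUV.Beta.FP.CoarseCovarianceStripMatrix` — road «FP» (binder row D1), row H′2-IR ∕ IR-2 (ii)∕(iv), file (M): **four [folklore] matrix letters**
# for `D × D` complex matrices in ENTRY currency — coercive ⟹ invertible with `‖F⁻¹ α β‖ ≤ 1∕γ`; coercivity survives an entrywise perturbation
# of size `η` with loss `D·η`; NEUMANN: `‖E α β‖ ≤ ε`, `D·ε ≤ ½` ⟹ `1 + E` invertible with `‖(1 + E)⁻¹ α β‖ ≤ 2`; a scalar factor pulls out of the inverse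

HONEST FRAMING (cell contract, verbatim): «discharging `BetaPertH` makes Bałaban's UV stability UNCONDITIONAL — a real constructive-QFT
result; it is NOT the continuum limit and NOT the Clay problem.»  HONEST DEPENDENCY (verbatim): «continuum YM on T⁴ ⇐ BetaPertH ∧ nine
spine estimates (0/9 proved); BetaPertH ⇐ (D1) ∧ (D4) ∧ CAP+tail; G-an2-4 gates asym, D1 and NE2/3/4.»  THIS MODULE DISCHARGES NOTHING of
D1 ∕ BetaPertH: [folklore] finite-dimensional linear algebra over Mathlib (`Matrix.mulVec_injective_iff_isUnit`, `Matrix.isUnit_iff_isUnit_det`,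
`Matrix.mul_nonsing_inv`, the sup norm of `Fin D → ℂ`) and gan24-leaf-05-g34's `PerfectPropagatorBound.norm_inv_entry_le` ∕
`PerfectPropagatorSymbol.quad` BY NAME.  No data def; no `def … : Prop`; nothing is cited; 0 sorry.  NOT summit progress; NOT BetaPertH,
NOT continuum, NOT Clay.

ABSOLUTE RULE (cell, verbatim): «No internally-minted statement may enter as a cited fact. Every hypothesis is either kernel-proved in this
package or a verbatim quotation of a PUBLISHED theorem with page reference. The manuscript(s) under audit are NOT citable for their own
disputed steps — they are the thing under adjudication; programme-internal (2001/route/tribunal) claims are never citable.»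

CONTENT (used by IR-2 (ii) file (A) `CoarseCovarianceStripProp` — the perfect propagator symbol on the cone region — and by (iv)).
* §1 `quad_add`, `norm_quad_le` (`‖quad G w‖ ≤ η·D·Σ‖w‖²` from `‖G α β‖ ≤ η`), **`re_quad_add_ge`** (coercivity `γ` of `F` and entry bound `η` of `G`
  give coercivity `γ − D·η` of `F + G`).
* §2 **`isUnit_det_of_coercive`** (`0 < γ`, `γ·Σ‖w‖² ≤ Re quad F w` ⟹ `IsUnit F.det`), **`norm_inv_entry_le_of_coercive`** (`‖F⁻¹ α β‖ ≤ 1∕γ`).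
* §3 `norm_mulVec_le` (`‖E v‖∞ ≤ D·ε·‖v‖∞`), **`neumann_entry`** (`‖E α β‖ ≤ ε`, `D·ε ≤ ½` ⟹ `IsUnit (1 + E).det ∧ ‖(1 + E)⁻¹ α β‖ ≤ 2`).
* §4 `inv_smul_eq` (`c ≠ 0`, `IsUnit B.det` ⟹ `IsUnit (c • B).det ∧ (c • B)⁻¹ = c⁻¹ • B⁻¹`).
Unit `b2b-balaban-beta-d1-formalise-leaf-06` (gen 7), owner ruling R-FP-21 (A3)∕(C), INTENT journal l.22234.
-/

noncomputable section

namespace Summit.QuantumFields.BalabanUV.Beta.FP.CoarseCovarianceStripMatrix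

open Finset Complex Matrix
open scoped BigOperators ComplexConjugate
open Summit.QuantumFields.BalabanUV.Beta.FP.PerfectPropagatorSymbol (quad quad_eq_dotProduct)
open Summit.QuantumFields.BalabanUV.Beta.FP.PerfectPropagatorBound (norm_inv_entry_le)

variable {m : ℕ}

/-! ## §1 The sesquilinear pairing under perturbation -/

/-- [folklore] `quad` is additive in the matrix. -/
theorem quad_add (F G : Matrix (Fin m) (Fin m) ℂ) (w : Fin m → ℂ) : quad (F + G) w = quad F w + quad G w := by
  simp only [quad, Matrix.add_apply, mul_add, add_mul, Finset.sum_add_distrib]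

/-- [folklore] `(Σ_α ‖w α‖)² ≤ D·Σ_α ‖w α‖²` (Cauchy–Schwarz against the constant vector). -/
theorem sq_sum_norm_le (w : Fin m → ℂ) : (∑ α, ‖w α‖) ^ 2 ≤ (m : ℝ) * ∑ α, ‖w α‖ ^ 2 := by
  have h := Finset.sum_mul_sq_le_sq_mul_sq (Finset.univ : Finset (Fin m)) (fun α => ‖w α‖) (fun _ => (1 : ℝ))
  simp only [mul_one, one_pow, Finset.sum_const, Finset.card_univ, Fintype.card_fin, nsmul_eq_mul] at h
  linarith

/-- [folklore] **ENTRY BOUND ⟹ FORM BOUND**: `‖G α β‖ ≤ η` for all entries gives `‖quad G w‖ ≤ η·D·Σ_α ‖w α‖²`. -/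
theorem norm_quad_le {G : Matrix (Fin m) (Fin m) ℂ} {η : ℝ} (hη : 0 ≤ η) (hG : ∀ α β, ‖G α β‖ ≤ η) (w : Fin m → ℂ) :
    ‖quad G w‖ ≤ η * m * ∑ α, ‖w α‖ ^ 2 := by
  unfold quad
  calc ‖∑ α, ∑ β, conj (w α) * G α β * w β‖
      ≤ ∑ α, ∑ β, ‖conj (w α) * G α β * w β‖ := (norm_sum_le _ _).trans (Finset.sum_le_sum fun α _ => norm_sum_le _ _)
    _ ≤ ∑ α, ∑ β, ‖w α‖ * η * ‖w β‖ := by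
        refine Finset.sum_le_sum fun α _ => Finset.sum_le_sum fun β _ => ?_
        rw [norm_mul, norm_mul, Complex.norm_conj]
        exact mul_le_mul_of_nonneg_right (mul_le_mul_of_nonneg_left (hG α β) (norm_nonneg _)) (norm_nonneg _)
    _ = η * (∑ α, ‖w α‖) ^ 2 := by
        rw [sq, Finset.sum_mul_sum, Finset.mul_sum]
        refine Finset.sum_congr rfl fun α _ => ?_
        rw [Finset.mul_sum]
        refine Finset.sum_congr rfl fun β _ => ?_
        ring
    _ ≤ η * ((m : ℝ) * ∑ α, ‖w α‖ ^ 2) := mul_le_mul_of_nonneg_left (sq_sum_norm_le w) hη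
    _ = η * m * ∑ α, ‖w α‖ ^ 2 := by ring

/-- [folklore] **COERCIVITY SURVIVES AN ENTRYWISE PERTURBATION**: `γ·Σ‖w‖² ≤ Re quad F w` and `‖G α β‖ ≤ η` give
`(γ − D·η)·Σ‖w‖² ≤ Re quad (F + G) w`. -/
theorem re_quad_add_ge {F G : Matrix (Fin m) (Fin m) ℂ} {γ η : ℝ} (hη : 0 ≤ η)
    (hF : ∀ w : Fin m → ℂ, γ * ∑ α, ‖w α‖ ^ 2 ≤ (quad F w).re) (hG : ∀ α β, ‖G α β‖ ≤ η) (w : Fin m → ℂ) :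
    (γ - m * η) * ∑ α, ‖w α‖ ^ 2 ≤ (quad (F + G) w).re := by
  rw [quad_add, Complex.add_re]
  have h1 := hF w
  have h2 : -(η * m * ∑ α, ‖w α‖ ^ 2) ≤ (quad G w).re := by
    have := (abs_le.mp ((Complex.abs_re_le_norm (quad G w)).trans (norm_quad_le hη hG w))).1
    linarith
  nlinarith

/-! ## §2 Coercive matrices are invertible, with entry bound `1/γ` on the inverse -/

/-- [folklore] **A COERCIVE MATRIX IS INVERTIBLE**: `0 < γ` and `γ·Σ‖w‖² ≤ Re quad F w` for all `w` give `IsUnit F.det`. -/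
theorem isUnit_det_of_coercive {F : Matrix (Fin m) (Fin m) ℂ} {γ : ℝ} (hγ : 0 < γ)
    (hF : ∀ w : Fin m → ℂ, γ * ∑ α, ‖w α‖ ^ 2 ≤ (quad F w).re) : IsUnit F.det := by
  have hinj : Function.Injective F.mulVec := by
    intro v w hvw
    have h0 : F *ᵥ (v - w) = 0 := by rw [Matrix.mulVec_sub, hvw, sub_self]
    have hq : quad F (v - w) = 0 := by rw [quad_eq_dotProduct, h0, dotProduct_zero]
    have h1 := hF (v - w)
    rw [hq, Complex.zero_re] at h1
    have hs : ∑ α, ‖(v - w) α‖ ^ 2 ≤ 0 := by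
      by_contra h; push Not at h
      have := mul_pos hγ h
      linarith
    have hs0 : ∑ α, ‖(v - w) α‖ ^ 2 = 0 := le_antisymm hs (Finset.sum_nonneg fun α _ => sq_nonneg _)
    have hall := (Finset.sum_eq_zero_iff_of_nonneg fun α _ => sq_nonneg ‖(v - w) α‖).mp hs0
    have : v - w = 0 := funext fun α => by
      have := hall α (Finset.mem_univ α)
      exact norm_eq_zero.mp (pow_eq_zero_iff (n := 2) (by norm_num) |>.mp this)
    exact sub_eq_zero.mp this
  exact (Matrix.isUnit_iff_isUnit_det F).mp (Matrix.mulVec_injective_iff_isUnit.mp hinj)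

/-- [folklore] **ENTRY BOUND OF THE INVERSE OF A COERCIVE MATRIX**: `‖F⁻¹ α β‖ ≤ 1/γ` (gan24-leaf-05-g34's `norm_inv_entry_le` with `P := F⁻¹`). -/
theorem norm_inv_entry_le_of_coercive {F : Matrix (Fin m) (Fin m) ℂ} {γ : ℝ} (hγ : 0 < γ)
    (hF : ∀ w : Fin m → ℂ, γ * ∑ α, ‖w α‖ ^ 2 ≤ (quad F w).re) (α β : Fin m) : ‖F⁻¹ α β‖ ≤ 1 / γ :=
  norm_inv_entry_le (Matrix.mul_nonsing_inv F (isUnit_det_of_coercive hγ hF)) hγ hF α β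

/-! ## §3 Neumann: `1 + E` with small entries -/

/-- [folklore] `‖(E v) α‖ ≤ D·ε·‖v‖` in the sup norm when `‖E α β‖ ≤ ε`. -/
theorem norm_mulVec_le {E : Matrix (Fin m) (Fin m) ℂ} {ε : ℝ} (hε : 0 ≤ ε) (hE : ∀ α β, ‖E α β‖ ≤ ε) (v : Fin m → ℂ) :
    ‖E *ᵥ v‖ ≤ m * ε * ‖v‖ := by
  refine (pi_norm_le_iff_of_nonneg (by positivity)).mpr fun α => ?_
  calc ‖(E *ᵥ v) α‖ = ‖∑ β, E α β * v β‖ := rfl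
    _ ≤ ∑ β, ‖E α β * v β‖ := norm_sum_le _ _
    _ ≤ ∑ _β : Fin m, ε * ‖v‖ := Finset.sum_le_sum fun β _ => by
        rw [norm_mul]; exact mul_le_mul (hE α β) (norm_le_pi_norm v β) (norm_nonneg _) hε
    _ = m * ε * ‖v‖ := by
        simp only [Finset.sum_const, Finset.card_univ, Fintype.card_fin, nsmul_eq_mul]; ring

/-- [folklore] **NEUMANN IN ENTRY CURRENCY**: `‖E α β‖ ≤ ε` with `D·ε ≤ ½` ⟹ `1 + E` is invertible and `‖(1 + E)⁻¹ α β‖ ≤ 2`. -/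
theorem neumann_entry {E : Matrix (Fin m) (Fin m) ℂ} {ε : ℝ} (hε : 0 ≤ ε) (hE : ∀ α β, ‖E α β‖ ≤ ε) (hmε : (m : ℝ) * ε ≤ 1 / 2) :
    IsUnit (1 + E).det ∧ ∀ α β, ‖(1 + E)⁻¹ α β‖ ≤ 2 := by
  have hEv : ∀ v : Fin m → ℂ, ‖E *ᵥ v‖ ≤ 1 / 2 * ‖v‖ := fun v =>
    (norm_mulVec_le hε hE v).trans (mul_le_mul_of_nonneg_right hmε (norm_nonneg _))
  have hinj : Function.Injective (1 + E).mulVec := by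
    intro v w hvw
    have h0 : (1 + E) *ᵥ (v - w) = 0 := by rw [Matrix.mulVec_sub, hvw, sub_self]
    rw [Matrix.add_mulVec, Matrix.one_mulVec] at h0
    have h2 : v - w = -(E *ᵥ (v - w)) := eq_neg_of_add_eq_zero_left h0
    have h3 : ‖v - w‖ ≤ 1 / 2 * ‖v - w‖ := by
      have := hEv (v - w)
      rw [← norm_neg (E *ᵥ (v - w)), ← h2] at this
      exact this
    have h4 : ‖v - w‖ = 0 := by linarith [norm_nonneg (v - w)]
    exact sub_eq_zero.mp (norm_eq_zero.mp h4)
  have hdet : IsUnit (1 + E).det := (Matrix.isUnit_iff_isUnit_det _).mp (Matrix.mulVec_injective_iff_isUnit.mp hinj)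
  refine ⟨hdet, fun α β => ?_⟩
  set c : Fin m → ℂ := fun α' => (1 + E)⁻¹ α' β with hcdef
  have hc : (1 + E) *ᵥ c = Pi.single β 1 := by
    have e : c = (1 + E)⁻¹ *ᵥ Pi.single β 1 := by rw [Matrix.mulVec_single_one]; rfl
    rw [e, Matrix.mulVec_mulVec, Matrix.mul_nonsing_inv _ hdet, Matrix.one_mulVec]
  rw [Matrix.add_mulVec, Matrix.one_mulVec] at hc
  have hc2 : c = Pi.single β 1 - E *ᵥ c := eq_sub_of_add_eq hc
  have hnc : ‖c‖ ≤ 1 + 1 / 2 * ‖c‖ := by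
    have h1 : ‖c‖ ≤ ‖(Pi.single β (1 : ℂ) : Fin m → ℂ)‖ + ‖E *ᵥ c‖ := by
      conv_lhs => rw [hc2]
      exact norm_sub_le _ _
    rw [Pi.norm_single, norm_one] at h1
    linarith [hEv c]
  have h2 : ‖c‖ ≤ 2 := by linarith
  exact (norm_le_pi_norm c α).trans h2

/-! ## §4 Scalar factors -/

/-- [folklore] **A NON-ZERO SCALAR FACTOR PULLS OUT OF THE INVERSE**: `c ≠ 0`, `IsUnit B.det` ⟹ `IsUnit (c • B).det ∧ (c • B)⁻¹ = c⁻¹ • B⁻¹`. -/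
theorem inv_smul_eq {B : Matrix (Fin m) (Fin m) ℂ} {c : ℂ} (hc : c ≠ 0) (hB : IsUnit B.det) :
    IsUnit (c • B).det ∧ (c • B)⁻¹ = c⁻¹ • B⁻¹ := by
  have hright : (c • B) * (c⁻¹ • B⁻¹) = 1 := by
    rw [Matrix.smul_mul, Matrix.mul_smul, Matrix.mul_nonsing_inv _ hB, smul_smul, mul_inv_cancel₀ hc, one_smul]
  exact ⟨Matrix.isUnit_det_of_right_inverse hright, Matrix.inv_eq_right_inv hright⟩

end Summit.QuantumFields.BalabanUV.Beta.FP.CoarseCovarianceStripMatrix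

end
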